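/-
Copyright (c) 2026 the pub-hodgecm-mathlib formalisation cell (harness21).  Prover seat hodgecm-mathlib-F0P3-p03 (g15): road «S3-ram» (LEAD F0P3a-plan (g12∕g13); owner
F0P3a-p06 (g15)); junction J-PACK v2-iso (pen F0P3a-p01 (g17); ISO-ROWS proposal F0P3a-p02 (g17) cfd30fc9), lattice half of the AXIS rows «AXIS PROPAGATION» v3; 2026-09-02.
-/
import Literature.NumberTheory.Automorphic.UnitaryLatticeTreeEigenlinePropagationRamified   -- ★ (F0P3a-p04 (g19)): odd-level congruences, parity rule, eigenline propagation at odd `d ≥ 2`; brings ★ `…FixedChildSameLevelRamified` (p847581), ★ H∕J∕G∕F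
import Literature.NumberTheory.Automorphic.UnitaryLatticeTreeFixedVertex   -- ★ (F0P2-p01): `scaleLattice_mono`, `scaleLattice_scaleLattice`
import HarnessLib

/-!
# The lattice graph of a hermitian space — AXIS PROPAGATION AT EVERY ODD LEVEL, `d = 1` INCLUDED (tame-ramified place): the exact skew-hermitian law, the second-order corner
# of a first-order eigenline, and the digit-uniform same-level criterion (Bruhat–Tits 1972 §10; Tits 1979 §3.5; Kottwitz 1986 §3)

Topic `NumberTheory/Automorphic`; namespace `Literature.NumberTheory.Automorphic.UnitaryLatticeTree`.  THEOREMS ONLY (no definition, no instance, no notation, no named fact,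
no `sorry`); kernel lane `--supports stmt-HodgeConjecture-24833`.  Cell `pub/hodgecm-mathlib` (D-0151), crux H413; road «S3-ram» (Literature seeding, count-neutral); junction
J-PACK v2-iso, the LATTICE half of the AXIS rows (ISO-ROWS proposal `F0/P3a/F0P3a-p02/g17/iso/ISO-ROWS-proposal.v1.F0P3ap02g17.md` §2; F0P3-p03 (g15) bus 2026-09-02T01:37Z).

THE POINT.  ★ `map_sub_one_childLatt_le_scaleLattice_of_eigenline_of_odd` (F0P3a-p04 (g19)) propagates the level `ϖ^d` through a first-order eigenline at ODD `d ≥ 2`; its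
proof uses the FIRST-order skew-hermitian law `Y_{ij} + σ(Y_{rev j, rev i}) ≡ 0 (ϖ^{2d})` (★ G `v_coe_sub_one_apply_add_sigma_rev_le`), which at `d = 1` — the depth of the
rung's own literal (`d₀ = N = 1`) — is one order short (`2d = 2 < d + 2 = 3`).  §1 records the EXACT law behind ★ G: for `γ ∈ U(σ, J₀)` and `Y = γ − 1`,
`Y_{ij} + σ(Y_{rev j, rev i}) = −Σ_k σ(Y_{k, rev i})·Y_{rev k, j}` (expand `B₀(γu, γv) = B₀(u, v)` at `u = e_{rev i}`, `v = e_j`).  At `(2,0)` the right side is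
`−(σ(Y₀₀)Y₂₀ + σ(Y₁₀)Y₁₀ + σ(Y₂₀)Y₀₀)`, which under the first-order EIGENLINE (`|Y₁₀|, |Y₂₀| ≤ |ϖ|^{d+1}`) is `≤ |ϖ|^{2d+1} ≤ |ϖ|^{d+2}` as soon as `d ≥ 1` (§2); the parity
rule at the even exponent `d + 1` then gives `|2Y₂₀| ≤ |ϖ|^{d+2}`, i.e. the SECOND-ORDER CORNER `|Y₂₀| ≤ |ϖ|^{d+2}` at EVERY odd level.  Hence §3: EIGENLINE ∕ AXIS PROPAGATION
and its pivot twin WITHOUT the hypothesis `2 ≤ d`.  §4 is the generic DIGIT-UNIFORM form of ★ `map_sub_one_childLatt_le_scaleLattice_iff_lower` (p847581): ALL integral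
digits `b` keep the level iff `M₁₀ ≡ M₂₁ ≡ 0`, `M₂₂ ≡ M₀₀ (ϖ^{d+1})` and `M₂₀ ≡ 0 (ϖ^{d+2})` (test `b = 0` and `b = 1`); §5 is the generic two-level degradation of any
lattice token from a vertex to the vertices between `ϖv` and `ϖ⁻¹v`.

* §1 **`coe_sub_one_apply_add_sigma_rev_eq_neg_sum`** — the exact skew-hermitian law in `U(σ, J₀)`.
* §2 `v_coe_sub_one_two_zero_add_sigma_le_of_eigenline`, **`v_coe_sub_one_two_zero_le_of_eigenline_of_odd`** (the second-order corner at every odd level).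
* §3 **`map_sub_one_childLatt_le_scaleLattice_of_eigenline_of_odd_level`** (AXIS PROPAGATION, odd `d ≥ 1`), **`v_one_zero_eq_of_corner_of_not_map_sub_one_childLatt_le_of_odd_level`**.
* §4 **`forall_map_sub_one_childLatt_le_scaleLattice_iff`** (digit-uniform same-level criterion; any `K`, any `d`, `κ γ ∈ GL₃`).
* §5 `map_le_scaleLattice_of_between` (a token of `v` at level `ϖ^{e+2}` holds at every `w` with `ϖv ≤ w ≤ ϖ⁻¹v` at level `ϖ^e`).

HONEST LABEL: HC_CM is proved only modulo the 2 remaining named inputs (hLiu418 24832, h413 24833) until rung 0 closes; nothing printed is asserted here (elementary matrix∕lattice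
algebra over a valuation ring); «S3-ram» has no books consequence.

## References
* [BruhatTits1972] F. Bruhat, J. Tits, *Groupes réductifs sur un corps local I*, Publ. Math. IHÉS 41 (1972), §10 (lattice models; vertex stabilisers and their filtrations).
* [Tits1979] J. Tits, *Reductive groups over local fields*, PSPM 33.1 (1979), §3.5 (congruence filtration at a ramified place).
* [Kottwitz1986] R. E. Kottwitz, *Base change for unit elements of Hecke algebras*, Compositio Math. 60 (1986), §3 (levels of fixed lattices of a torus element).
* [Serre1980Trees] J.-P. Serre, *Trees* (1980), Ch. II §1.1–1.2 (lattices, neighbours, levels).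
-/

set_option autoImplicit false

noncomputable section

open scoped Valued WithZero Matrix MatrixGroups

namespace Literature.NumberTheory.Automorphic.UnitaryLatticeTree

open Literature.NumberTheory.Automorphic Literature.NumberTheory.Automorphic.HermitianLattice

variable {K : Type*} [Field K] [Valued K ℤᵐ⁰] {σ : K →+* K} {ϖ : K}

/-! ## §1 The exact skew-hermitian law in `U(σ, J₀)` -/

omit [Valued K ℤᵐ⁰] in
/-- **THE EXACT SKEW-HERMITIAN LAW.**  For `γ ∈ U(σ, J₀)` (`J₀ = antidiag(1,1,1)`) and `Y = γ − 1`: `Y_{ij} + σ(Y_{rev j, rev i}) = −Σ_k σ(Y_{k, rev i})·Y_{rev k, j}`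
(the `(e_{rev i}, e_j)` coefficient of `B₀(γu, γv) = B₀(u, v)`, `γ = 1 + Y`): `Y + Y^† = −Y^†Y` exactly, of which ★ G `v_coe_sub_one_apply_add_sigma_rev_le` is the
first-order shadow. [cite: BruhatTits1972, §10] [cite: Tits1979, §3.5] -/
theorem coe_sub_one_apply_add_sigma_rev_eq_neg_sum (γ : unitaryGroupOfForm σ ((StdForm.antidiagonal 3).over K)) (i j : Fin 3) :
    (((γ : GL (Fin 3) K) : Matrix (Fin 3) (Fin 3) K) - 1) i j + σ ((((γ : GL (Fin 3) K) : Matrix (Fin 3) (Fin 3) K) - 1) j.rev i.rev) =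
      -∑ k, σ ((((γ : GL (Fin 3) K) : Matrix (Fin 3) (Fin 3) K) - 1) k i.rev) * (((γ : GL (Fin 3) K) : Matrix (Fin 3) (Fin 3) K) - 1) k.rev j := by
  set Y : Matrix (Fin 3) (Fin 3) K := ((γ : GL (Fin 3) K) : Matrix (Fin 3) (Fin 3) K) - 1 with hYdef
  have hγu := (mem_unitaryGroupOfForm_antidiagonal_iff (γ : GL (Fin 3) K)).1 γ.2
  have hγY : ((γ : GL (Fin 3) K) : Matrix (Fin 3) (Fin 3) K) = 1 + Y := by rw [hYdef, add_sub_cancel]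
  -- expand `B₀(γu, γv) = B₀(u,v)` with `γ = 1 + Y`
  have hexp : ∀ u v : Fin 3 → K, B₀ σ 3 u (Y.mulVec v) + B₀ σ 3 (Y.mulVec u) v = -B₀ σ 3 (Y.mulVec u) (Y.mulVec v) := by
    intro u v
    have h := hγu u v
    rw [hγY, Matrix.add_mulVec, Matrix.add_mulVec, Matrix.one_mulVec, Matrix.one_mulVec, map_add, map_add, LinearMap.add_apply, LinearMap.add_apply] at h
    have h' : B₀ σ 3 u (Y.mulVec v) + B₀ σ 3 (Y.mulVec u) v + B₀ σ 3 (Y.mulVec u) (Y.mulVec v) = 0 := by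
      have := sub_eq_zero.2 h
      rw [← this]; abel
    rw [eq_neg_iff_add_eq_zero, h']
  have h := hexp (Pi.single i.rev 1) (Pi.single j 1)
  rw [Matrix.mulVec_single_one, Matrix.mulVec_single_one, B₀_single_left, B₀_single_right, Fin.rev_rev] at h
  rw [Matrix.col_apply, Matrix.col_apply] at h
  rw [h, B₀_apply]
  simp only [Matrix.col_apply]

/-! ## §2 The second-order corner of a first-order eigenline, at every odd level -/

/-- **`|Y₂₀ + σ(Y₂₀)| ≤ |ϖ|^d·|ϖ|^{d+1}` through a first-order eigenline.**  `γ ∈ U(σ, J₀)`, `Y = γ − 1` of level `ϖ^d`, `|Y₁₀|, |Y₂₀| ≤ |ϖ|^{d+1}`: by §1 at `(2,0)`,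
`Y₂₀ + σ(Y₂₀) = −(σ(Y₀₀)Y₂₀ + σ(Y₁₀)Y₁₀ + σ(Y₂₀)Y₀₀)`. [cite: BruhatTits1972, §10] [cite: Tits1979, §3.5] -/
theorem v_coe_sub_one_two_zero_add_sigma_le_of_eigenline (hvσ : ∀ z, Valued.v (σ z) = Valued.v z) (hϖ : Valued.v ϖ = WithZero.exp (-1 : ℤ))
    (γ : unitaryGroupOfForm σ ((StdForm.antidiagonal 3).over K)) {d : ℕ}
    (hY : ∀ i j, Valued.v ((((γ : GL (Fin 3) K) : Matrix (Fin 3) (Fin 3) K) - 1) i j) ≤ Valued.v ϖ ^ d)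
    (h10 : Valued.v ((((γ : GL (Fin 3) K) : Matrix (Fin 3) (Fin 3) K) - 1) 1 0) ≤ Valued.v ϖ ^ (d + 1))
    (h20 : Valued.v ((((γ : GL (Fin 3) K) : Matrix (Fin 3) (Fin 3) K) - 1) 2 0) ≤ Valued.v ϖ ^ (d + 1)) :
    Valued.v ((((γ : GL (Fin 3) K) : Matrix (Fin 3) (Fin 3) K) - 1) 2 0 + σ ((((γ : GL (Fin 3) K) : Matrix (Fin 3) (Fin 3) K) - 1) 2 0)) ≤
      Valued.v ϖ ^ d * Valued.v ϖ ^ (d + 1) := by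
  have hϖ1 : Valued.v ϖ ≤ 1 := by rw [hϖ, ← WithZero.exp_zero]; exact WithZero.exp_le_exp.2 (by norm_num)
  set Y : Matrix (Fin 3) (Fin 3) K := ((γ : GL (Fin 3) K) : Matrix (Fin 3) (Fin 3) K) - 1 with hYdef
  have h := coe_sub_one_apply_add_sigma_rev_eq_neg_sum γ 2 0
  have hr0 : (0 : Fin 3).rev = 2 := rfl
  have hr2 : (2 : Fin 3).rev = 0 := rfl
  rw [hr0, hr2] at h
  rw [h, Valuation.map_neg]
  refine Valuation.map_sum_le _ fun k _ => ?_
  rw [map_mul, hvσ]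
  fin_cases k
  · show Valued.v (Y 0 0) * Valued.v (Y 2 0) ≤ _
    exact mul_le_mul' (hY 0 0) h20
  · show Valued.v (Y 1 0) * Valued.v (Y 1 0) ≤ _
    exact mul_le_mul' (h10.trans (pow_le_pow_right_of_le_one' hϖ1 (by omega))) h10
  · show Valued.v (Y 2 0) * Valued.v (Y 0 0) ≤ _
    rw [mul_comm]; exact mul_le_mul' (hY 0 0) h20

/-- **THE SECOND-ORDER CORNER AT EVERY ODD LEVEL (`d = 1` included).**  `γ ∈ U(σ, J₀)`, `Y = γ − 1` of ODD level `ϖ^d` (ramified place: `σϖ = −ϖ`, `σ` residually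
trivial, `|2| = 1`), and `|Y₁₀|, |Y₂₀| ≤ |ϖ|^{d+1}` (first-order eigenline): then **`|Y₂₀| ≤ |ϖ|^{d+2}`** — `2Y₂₀ = (Y₂₀ + σY₂₀) − (σY₂₀ − Y₂₀)` with the first bracket
`≤ |ϖ|^{2d+1} ≤ |ϖ|^{d+2}` (previous lemma, `d ≥ 1`) and the second `≤ |ϖ|^{d+2}` (parity rule at the even exponent `d+1`).  Removes the hypothesis `2 ≤ d` of ★
`v_coe_sub_one_two_zero_le_of_odd`. [cite: BruhatTits1972, §10] [cite: Tits1979, §3.5] [cite: Kottwitz1986, §3] -/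
theorem v_coe_sub_one_two_zero_le_of_eigenline_of_odd (hvσ : ∀ z, Valued.v (σ z) = Valued.v z) (hσϖ : σ ϖ = -ϖ) (hϖ : Valued.v ϖ = WithZero.exp (-1 : ℤ))
    (hres : ∀ x : K, Valued.v x ≤ 1 → Valued.v (σ x - x) < 1) (h2 : Valued.v (2 : K) = 1)
    (γ : unitaryGroupOfForm σ ((StdForm.antidiagonal 3).over K)) {d : ℕ} (hodd : Odd d)
    (hY : ∀ i j, Valued.v ((((γ : GL (Fin 3) K) : Matrix (Fin 3) (Fin 3) K) - 1) i j) ≤ Valued.v ϖ ^ d)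
    (h10 : Valued.v ((((γ : GL (Fin 3) K) : Matrix (Fin 3) (Fin 3) K) - 1) 1 0) ≤ Valued.v ϖ ^ (d + 1))
    (h20 : Valued.v ((((γ : GL (Fin 3) K) : Matrix (Fin 3) (Fin 3) K) - 1) 2 0) ≤ Valued.v ϖ ^ (d + 1)) :
    Valued.v ((((γ : GL (Fin 3) K) : Matrix (Fin 3) (Fin 3) K) - 1) 2 0) ≤ Valued.v ϖ ^ (d + 2) := by
  have hϖ1 : Valued.v ϖ ≤ 1 := by rw [hϖ, ← WithZero.exp_zero]; exact WithZero.exp_le_exp.2 (by norm_num)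
  have hd : 1 ≤ d := hodd.pos
  set Y : Matrix (Fin 3) (Fin 3) K := ((γ : GL (Fin 3) K) : Matrix (Fin 3) (Fin 3) K) - 1 with hYdef
  have h := v_coe_sub_one_two_zero_add_sigma_le_of_eigenline hvσ hϖ γ hY h10 h20
  have h2d : Valued.v ϖ ^ d * Valued.v ϖ ^ (d + 1) ≤ Valued.v ϖ ^ (d + 2) := by
    rw [← pow_add]; exact pow_le_pow_right_of_le_one' hϖ1 (by omega)
  have hpar := v_map_sub_neg_one_pow_mul_le hσϖ hϖ hres h20
  rw [hodd.add_one.neg_one_pow, one_mul] at hpar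
  have h2Y : Valued.v (2 * Y 2 0) ≤ Valued.v ϖ ^ (d + 2) := by
    rw [show 2 * Y 2 0 = (Y 2 0 + σ (Y 2 0)) - (σ (Y 2 0) - Y 2 0) by ring]
    exact (Valuation.map_sub _ _ _).trans (max_le (h.trans h2d) hpar)
  rwa [map_mul, h2, one_mul] at h2Y

/-! ## §3 Axis propagation at every odd level, and the pivot twin -/

/-- **AXIS ∕ EIGENLINE PROPAGATION AT EVERY ODD LEVEL.**  `κ, γ ∈ U(σ, J₀)`, `M = κ⁻¹(γ−1)κ` of ODD level `ϖ^d` (`d = 1` allowed; ramified place, `|2| = 1`), the line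
`x̄ = κe₀` a first-order eigenline (`|M₁₀|, |M₂₀| ≤ |ϖ|^{d+1}`): then EVERY neighbour `Λ′ = latt(κ·g(a,b))` through `x̄` (`|a| = 1`, `|b| ≤ 1`) keeps the level,
`(γ−1)·Λ′ ⊆ ϖ^d·Λ′` — ★ `map_sub_one_childLatt_le_scaleLattice_of_eigenline_of_odd` without `2 ≤ d` (§2 supplies the corner). [cite: Kottwitz1986, §3] [cite: BruhatTits1972, §10] -/
theorem map_sub_one_childLatt_le_scaleLattice_of_eigenline_of_odd_level (hvσ : ∀ z, Valued.v (σ z) = Valued.v z) (hσϖ : σ ϖ = -ϖ)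
    (hϖ : Valued.v ϖ = WithZero.exp (-1 : ℤ)) (hres : ∀ x : K, Valued.v x ≤ 1 → Valued.v (σ x - x) < 1) (h2 : Valued.v (2 : K) = 1)
    (κ γ : unitaryGroupOfForm σ ((StdForm.antidiagonal 3).over K)) {a b : K} (ha : Valued.v a = 1) (hb : Valued.v b ≤ 1) {d : ℕ} (hodd : Odd d)
    (hM : ∀ i j, Valued.v (((((κ : GL (Fin 3) K)⁻¹ : GL (Fin 3) K) : Matrix (Fin 3) (Fin 3) K) * (((γ : GL (Fin 3) K) : Matrix (Fin 3) (Fin 3) K) - 1) *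
      ((κ : GL (Fin 3) K) : Matrix (Fin 3) (Fin 3) K)) i j) ≤ Valued.v ϖ ^ d)
    (h10 : Valued.v (((((κ : GL (Fin 3) K)⁻¹ : GL (Fin 3) K) : Matrix (Fin 3) (Fin 3) K) * (((γ : GL (Fin 3) K) : Matrix (Fin 3) (Fin 3) K) - 1) *
      ((κ : GL (Fin 3) K) : Matrix (Fin 3) (Fin 3) K)) 1 0) ≤ Valued.v ϖ ^ (d + 1))
    (h20 : Valued.v (((((κ : GL (Fin 3) K)⁻¹ : GL (Fin 3) K) : Matrix (Fin 3) (Fin 3) K) * (((γ : GL (Fin 3) K) : Matrix (Fin 3) (Fin 3) K) - 1) *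
      ((κ : GL (Fin 3) K) : Matrix (Fin 3) (Fin 3) K)) 2 0) ≤ Valued.v ϖ ^ (d + 1)) :
    (latt (((κ : GL (Fin 3) K) : Matrix (Fin 3) (Fin 3) K) * !![a / ϖ, 0, 0; 0, 1, 0; b, 0, ϖ])).map
        ((Matrix.toLin' (((γ : GL (Fin 3) K) : Matrix (Fin 3) (Fin 3) K) - 1)).restrictScalars 𝒪[K]) ≤
      scaleLattice (ϖ ^ d) (latt (((κ : GL (Fin 3) K) : Matrix (Fin 3) (Fin 3) K) * !![a / ϖ, 0, 0; 0, 1, 0; b, 0, ϖ])) := by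
  set M : Matrix (Fin 3) (Fin 3) K := (((κ : GL (Fin 3) K)⁻¹ : GL (Fin 3) K) : Matrix (Fin 3) (Fin 3) K) * (((γ : GL (Fin 3) K) : Matrix (Fin 3) (Fin 3) K) - 1) *
      ((κ : GL (Fin 3) K) : Matrix (Fin 3) (Fin 3) K) with hMdef
  -- `M = (κ⁻¹γκ) − 1` for the unitary `κ⁻¹γκ`
  have hY : ∀ i j, Valued.v (((((κ⁻¹ * γ * κ : unitaryGroupOfForm σ ((StdForm.antidiagonal 3).over K)) : GL (Fin 3) K) : Matrix (Fin 3) (Fin 3) K) - 1) i j) ≤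
      Valued.v ϖ ^ d := by
    intro i j; rw [coe_inv_mul_mul_sub_one]; exact hM i j
  have h21 := v_coe_sub_one_two_one_le_of_one_zero_le hvσ hϖ (κ⁻¹ * γ * κ) hodd.pos hY (by rw [coe_inv_mul_mul_sub_one]; exact h10)
  have h2200 := v_coe_sub_one_two_two_sub_zero_zero_le_of_odd hvσ hσϖ hϖ hres (κ⁻¹ * γ * κ) hodd.pos hodd hY
  have h20' := v_coe_sub_one_two_zero_le_of_eigenline_of_odd hvσ hσϖ hϖ hres h2 (κ⁻¹ * γ * κ) hodd hY (by rw [coe_inv_mul_mul_sub_one]; exact h10)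
    (by rw [coe_inv_mul_mul_sub_one]; exact h20)
  rw [coe_inv_mul_mul_sub_one] at h21 h2200 h20'
  refine (map_sub_one_childLatt_le_scaleLattice_iff_lower hϖ (κ : GL (Fin 3) K) (γ : GL (Fin 3) K) ha hb hM).2 ⟨h10, h21, ?_⟩
  refine (Valuation.map_add _ _ _).trans (max_le ?_ ?_)
  · rw [map_mul, ha, one_mul]; exact h20'
  · rw [map_mul, map_mul]
    calc Valued.v ϖ * Valued.v b * Valued.v (M 2 2 - M 0 0) ≤ Valued.v ϖ * 1 * Valued.v ϖ ^ (d + 1) := mul_le_mul' (mul_le_mul' le_rfl hb) h2200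
      _ = Valued.v ϖ ^ (d + 2) := by rw [mul_one, ← pow_succ']

/-- **THE PIVOT THROUGH A NULL LINE WITH A GRANDCHILD OFF THE LEVEL, AT EVERY ODD LEVEL.**  Same data (odd `d`, `d = 1` allowed); if the corner passes to first order
(`|M₂₀| ≤ |ϖ|^{d+1}`) and SOME neighbour `latt(κ·g(a,b))` through the line does NOT keep the level, then `|M₁₀| = |ϖ|^d` (the line is not an eigenline) — ★
`v_one_zero_eq_of_corner_of_not_map_sub_one_childLatt_le` without `2 ≤ d`. [cite: Kottwitz1986, §3] [cite: BruhatTits1972, §10] -/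
theorem v_one_zero_eq_of_corner_of_not_map_sub_one_childLatt_le_of_odd_level (hvσ : ∀ z, Valued.v (σ z) = Valued.v z) (hσϖ : σ ϖ = -ϖ)
    (hϖ : Valued.v ϖ = WithZero.exp (-1 : ℤ)) (hres : ∀ x : K, Valued.v x ≤ 1 → Valued.v (σ x - x) < 1) (h2 : Valued.v (2 : K) = 1)
    (κ γ : unitaryGroupOfForm σ ((StdForm.antidiagonal 3).over K)) {a b : K} (ha : Valued.v a = 1) (hb : Valued.v b ≤ 1) {d : ℕ} (hodd : Odd d)
    (hM : ∀ i j, Valued.v (((((κ : GL (Fin 3) K)⁻¹ : GL (Fin 3) K) : Matrix (Fin 3) (Fin 3) K) * (((γ : GL (Fin 3) K) : Matrix (Fin 3) (Fin 3) K) - 1) *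
      ((κ : GL (Fin 3) K) : Matrix (Fin 3) (Fin 3) K)) i j) ≤ Valued.v ϖ ^ d)
    (h20 : Valued.v (((((κ : GL (Fin 3) K)⁻¹ : GL (Fin 3) K) : Matrix (Fin 3) (Fin 3) K) * (((γ : GL (Fin 3) K) : Matrix (Fin 3) (Fin 3) K) - 1) *
      ((κ : GL (Fin 3) K) : Matrix (Fin 3) (Fin 3) K)) 2 0) ≤ Valued.v ϖ ^ (d + 1))
    (hnot : ¬ (latt (((κ : GL (Fin 3) K) : Matrix (Fin 3) (Fin 3) K) * !![a / ϖ, 0, 0; 0, 1, 0; b, 0, ϖ])).map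
        ((Matrix.toLin' (((γ : GL (Fin 3) K) : Matrix (Fin 3) (Fin 3) K) - 1)).restrictScalars 𝒪[K]) ≤
      scaleLattice (ϖ ^ d) (latt (((κ : GL (Fin 3) K) : Matrix (Fin 3) (Fin 3) K) * !![a / ϖ, 0, 0; 0, 1, 0; b, 0, ϖ]))) :
    Valued.v (((((κ : GL (Fin 3) K)⁻¹ : GL (Fin 3) K) : Matrix (Fin 3) (Fin 3) K) * (((γ : GL (Fin 3) K) : Matrix (Fin 3) (Fin 3) K) - 1) *
      ((κ : GL (Fin 3) K) : Matrix (Fin 3) (Fin 3) K)) 1 0) = Valued.v ϖ ^ d := by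
  have hϖ0 : ϖ ≠ 0 := fun h0 => by rw [h0, map_zero] at hϖ; exact WithZero.coe_ne_zero hϖ.symm
  have hvϖ0 : Valued.v ϖ ≠ 0 := (Valuation.ne_zero_iff _).2 hϖ0
  by_contra hne
  have hlt := lt_of_le_of_ne (hM 1 0) hne
  have hdm : Valued.v ϖ ^ d = Valued.v ϖ ^ (d + 1) * WithZero.exp (1 : ℤ) := by
    rw [pow_succ, hϖ, mul_assoc, ← WithZero.exp_add]; norm_num
  rw [hdm] at hlt
  have h10 := (WithZero.lt_mul_exp_iff_le (pow_ne_zero _ hvϖ0)).1 hlt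
  exact hnot (map_sub_one_childLatt_le_scaleLattice_of_eigenline_of_odd_level hvσ hσϖ hϖ hres h2 κ γ ha hb hodd hM h10 h20)

/-! ## §4 The digit-uniform same-level criterion -/

/-- **ALL DIGITS KEEP THE LEVEL iff EIGENLINE + SECOND-ORDER CORNER.**  For `κ, γ ∈ GL₃(K)`, `M = κ⁻¹(γ−1)κ` of level `ϖ^d` and a unit `a`: EVERY neighbour
`latt(κ·g(a,b))` with `|b| ≤ 1` keeps the level `ϖ^d` iff `|M₁₀|, |M₂₁| ≤ |ϖ|^{d+1}`, `|M₂₂ − M₀₀| ≤ |ϖ|^{d+1}` and `|M₂₀| ≤ |ϖ|^{d+2}` — test the digits `b = 0`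
(`⇒ M₂₀`) and `b = 1` (`⇒ ϖ(M₂₂ − M₀₀)`) in ★ `map_sub_one_childLatt_le_scaleLattice_iff_lower`.  (Any field `K`, any `d`; no unitarity.) [cite: Kottwitz1986, §3] [cite: Serre1980Trees, II.1.1] -/
theorem forall_map_sub_one_childLatt_le_scaleLattice_iff (hϖ : Valued.v ϖ = WithZero.exp (-1 : ℤ)) (κ γ : GL (Fin 3) K) {a : K} (ha : Valued.v a = 1) {d : ℕ}
    (hM : ∀ i j, Valued.v (((((κ⁻¹ : GL (Fin 3) K)) : Matrix (Fin 3) (Fin 3) K) * ((γ : Matrix (Fin 3) (Fin 3) K) - 1) * (κ : Matrix (Fin 3) (Fin 3) K)) i j) ≤ Valued.v ϖ ^ d) :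
    (∀ b : K, Valued.v b ≤ 1 →
      (latt ((κ : Matrix (Fin 3) (Fin 3) K) * !![a / ϖ, 0, 0; 0, 1, 0; b, 0, ϖ])).map ((Matrix.toLin' ((γ : Matrix (Fin 3) (Fin 3) K) - 1)).restrictScalars 𝒪[K]) ≤
        scaleLattice (ϖ ^ d) (latt ((κ : Matrix (Fin 3) (Fin 3) K) * !![a / ϖ, 0, 0; 0, 1, 0; b, 0, ϖ]))) ↔
      Valued.v (((((κ⁻¹ : GL (Fin 3) K)) : Matrix (Fin 3) (Fin 3) K) * ((γ : Matrix (Fin 3) (Fin 3) K) - 1) * (κ : Matrix (Fin 3) (Fin 3) K)) 1 0) ≤ Valued.v ϖ ^ (d + 1) ∧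
      Valued.v (((((κ⁻¹ : GL (Fin 3) K)) : Matrix (Fin 3) (Fin 3) K) * ((γ : Matrix (Fin 3) (Fin 3) K) - 1) * (κ : Matrix (Fin 3) (Fin 3) K)) 2 1) ≤ Valued.v ϖ ^ (d + 1) ∧
      Valued.v (((((κ⁻¹ : GL (Fin 3) K)) : Matrix (Fin 3) (Fin 3) K) * ((γ : Matrix (Fin 3) (Fin 3) K) - 1) * (κ : Matrix (Fin 3) (Fin 3) K)) 2 2 -
        ((((κ⁻¹ : GL (Fin 3) K)) : Matrix (Fin 3) (Fin 3) K) * ((γ : Matrix (Fin 3) (Fin 3) K) - 1) * (κ : Matrix (Fin 3) (Fin 3) K)) 0 0) ≤ Valued.v ϖ ^ (d + 1) ∧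
      Valued.v (((((κ⁻¹ : GL (Fin 3) K)) : Matrix (Fin 3) (Fin 3) K) * ((γ : Matrix (Fin 3) (Fin 3) K) - 1) * (κ : Matrix (Fin 3) (Fin 3) K)) 2 0) ≤ Valued.v ϖ ^ (d + 2) := by
  have hϖ0 : ϖ ≠ 0 := fun h0 => by rw [h0, map_zero] at hϖ; exact WithZero.coe_ne_zero hϖ.symm
  have hvϖ0 : Valued.v ϖ ≠ 0 := (Valuation.ne_zero_iff _).2 hϖ0
  set M : Matrix (Fin 3) (Fin 3) K := (((κ⁻¹ : GL (Fin 3) K)) : Matrix (Fin 3) (Fin 3) K) * ((γ : Matrix (Fin 3) (Fin 3) K) - 1) * (κ : Matrix (Fin 3) (Fin 3) K)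
    with hMdef
  constructor
  · intro h
    have hb0 : Valued.v (0 : K) ≤ 1 := by rw [map_zero]; exact zero_le
    have hb1 : Valued.v (1 : K) ≤ 1 := by rw [map_one]
    obtain ⟨h10, h21, hc0⟩ := (map_sub_one_childLatt_le_scaleLattice_iff_lower hϖ κ γ ha hb0 hM).1 (h 0 hb0)
    obtain ⟨-, -, hc1⟩ := (map_sub_one_childLatt_le_scaleLattice_iff_lower hϖ κ γ ha hb1 hM).1 (h 1 hb1)
    have h20 : Valued.v (M 2 0) ≤ Valued.v ϖ ^ (d + 2) := by
      have e : a * M 2 0 + ϖ * 0 * (M 2 2 - M 0 0) = a * M 2 0 := by ring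
      rw [e, map_mul, ha, one_mul] at hc0
      exact hc0
    have hϖM : Valued.v (ϖ * (M 2 2 - M 0 0)) ≤ Valued.v ϖ ^ (d + 2) := by
      have e : ϖ * (M 2 2 - M 0 0) = (a * M 2 0 + ϖ * 1 * (M 2 2 - M 0 0)) - a * M 2 0 := by ring
      rw [e]
      refine (Valuation.map_sub _ _ _).trans (max_le hc1 ?_)
      rw [map_mul, ha, one_mul]; exact h20
    have hdiag : Valued.v (M 2 2 - M 0 0) ≤ Valued.v ϖ ^ (d + 1) := by
      rw [map_mul, pow_succ'] at hϖM
      calc Valued.v (M 2 2 - M 0 0) = (Valued.v ϖ)⁻¹ * (Valued.v ϖ * Valued.v (M 2 2 - M 0 0)) := by rw [← mul_assoc, inv_mul_cancel₀ hvϖ0, one_mul]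
        _ ≤ (Valued.v ϖ)⁻¹ * (Valued.v ϖ * Valued.v ϖ ^ (d + 1)) := mul_le_mul' le_rfl hϖM
        _ = Valued.v ϖ ^ (d + 1) := by rw [← mul_assoc, inv_mul_cancel₀ hvϖ0, one_mul]
    exact ⟨h10, h21, hdiag, h20⟩
  · rintro ⟨h10, h21, hdiag, h20⟩ b hb
    refine (map_sub_one_childLatt_le_scaleLattice_iff_lower hϖ κ γ ha hb hM).2 ⟨h10, h21, ?_⟩
    refine (Valuation.map_add _ _ _).trans (max_le ?_ ?_)
    · rw [map_mul, ha, one_mul]; exact h20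
    · rw [map_mul, map_mul]
      calc Valued.v ϖ * Valued.v b * Valued.v (M 2 2 - M 0 0) ≤ Valued.v ϖ * 1 * Valued.v ϖ ^ (d + 1) := mul_le_mul' (mul_le_mul' le_rfl hb) hdiag
        _ = Valued.v ϖ ^ (d + 2) := by rw [mul_one, ← pow_succ']

/-! ## §5 Any token degrades by at most two levels from a vertex to its grandchildren -/

/-- **TWO-LEVEL DEGRADATION.**  If `ϖ·v ≤ w ≤ ϖ⁻¹·v` (e.g. `w` a grandchild of `v` in the lattice tree) and `A·v ⊆ ϖ^{e+2}·v` for a matrix `A` (any token: `(γ−1)^k`, a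
shifted square `(γ−1)(γ−1−μ)`, …), then `A·w ⊆ ϖ^e·w` (`A·w ⊆ ϖ⁻¹A·v ⊆ ϖ^{e+1}·v ⊆ ϖ^e·w`): every lattice token of `v` at level `ϖ^{e+2}` holds at `w` at level `ϖ^e`.
[cite: Serre1980Trees, II.1.1] [cite: Kottwitz1986, §3] -/
theorem map_le_scaleLattice_of_between (hϖ0 : ϖ ≠ 0) {N : ℕ} (A : Matrix (Fin N) (Fin N) K) {v w : Submodule 𝒪[K] (Fin N → K)}
    (hvw : scaleLattice ϖ v ≤ w) (hwv : w ≤ scaleLattice ϖ⁻¹ v) {e : ℕ}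
    (hA : v.map ((Matrix.toLin' A).restrictScalars 𝒪[K]) ≤ scaleLattice (ϖ ^ (e + 2)) v) :
    w.map ((Matrix.toLin' A).restrictScalars 𝒪[K]) ≤ scaleLattice (ϖ ^ e) w := by
  have hAw : w.map ((Matrix.toLin' A).restrictScalars 𝒪[K]) ≤ (scaleLattice ϖ⁻¹ v).map ((Matrix.toLin' A).restrictScalars 𝒪[K]) := Submodule.map_mono hwv
  have hcomm : (scaleLattice ϖ⁻¹ v).map ((Matrix.toLin' A).restrictScalars 𝒪[K]) = scaleLattice ϖ⁻¹ (v.map ((Matrix.toLin' A).restrictScalars 𝒪[K])) :=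
    (scaleLattice_map ϖ⁻¹ A v).symm
  refine hAw.trans ?_
  rw [hcomm]
  refine (scaleLattice_mono ϖ⁻¹ hA).trans ?_
  rw [scaleLattice_scaleLattice, show ϖ⁻¹ * ϖ ^ (e + 2) = ϖ ^ e * ϖ by rw [pow_add, pow_two]; field_simp, ← scaleLattice_scaleLattice]
  exact scaleLattice_mono _ hvw

end Literature.NumberTheory.Automorphic.UnitaryLatticeTree

end
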